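import Summits.QuantumFields.YangMills.Theorems.FluctuationComparisonRegPrIntLS2BetaRelativeTowerSupProfile
import Summits.QuantumFields.YangMills.Theorems.FluctuationComparisonRegPrIntLS2BetaWhitneyHatLiftCurvatureSecondOrderGlobal
import HarnessLib

/-!
# S2β · (L♭) road, way-out (a) — THE `s`-STEP OF THE TWO-PROFILE SUP RECURSION: the one-level sup letter of the relative stage tower with the REFINED lift
# curvature, `arc (W b) ≤ L⁻¹·s + (π∕2)·( N_P·(aW + L⁻²·(aX + (aX + 12s²)² + 40sv + 8v² + 35s³)) + ((d+2)L)²∕2·aW )` — NO `s²` (`d = 3`)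

Cell `ym3-torus` (rung R3 = continuum `SU(2)` Yang–Mills on the three-torus — NOT d = 4, NOT infinite volume, NOT a mass gap, NOT Clay).
Width seat «width 21» `ym3-torus-px21` (gen 23); `--kind proof --supports stmt-QuantumFields-20520 --as helper`, count-neutral, DEFINITION-FREE
(0 `def`, 0 `instance`, 0 `notation`, 0 `sorry`, default heartbeats).  ONE theorem: px17 g19's ✓`…RelativeTowerSupProfile.arc_le_sup_step_hatLift` VERBATIM in
mechanism (comb bonds carry the lift ✓`arc_lift_le`; the others add fluxes ✓`arc_le_of_axial_pair`; spine quotient = correction factor), with ONE input replaced: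
the lift's plaquettes are read by ✓`…WhitneyHatLiftCurvatureSecondOrderGlobal.dist1_plaqHol_lift_le_second_of_forall` (`(L⁻¹)²·(aX + (aX+12s²)² + 40sv + 8v² + 35s³)`,
chord currency — no `π∕2` on `aX`) instead of ✓`dist1_plaqHol_lift_le_of_forall` (`(L⁻¹)²·((π∕2)aX + 24s²)`).

WHY (UV3-NODE §88).  This is the `s`-STEP of the two-profile `(s, v)` recursion whose bootstrap is ✓∕⧗`…ContractingSupVarStart.sup_bootstrap_two_profile`:
`s_t ≤ L⁻¹s_{t+1} + ρ_t + C₃s_{t+1}³ + Csv·s_{t+1}v_{t+1} + Cvv·v_{t+1}²` with `C₃ = κ·(35 + 36)` (the `144s⁴ ≤ 36s³` of `(aX+12s²)²` at `s ≤ 1∕4` joins the cube),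
`Csv = 40κ`, `Cvv = 8κ`, `κ = (π∕2)·N_P·L⁻²`, `ρ_t` a threshold sum (`aW`, `aX`, `aX²`, `24·aX·s² ≤ 1.5·aX`).  The `v`-STEP (the variation of the comb-axial correction
factors — the located `Dsv`, a lattice Bianchi count) is NOT here and is the one open kinematic file of way-out (a).

HONEST SCOPE.  Plumbing over landed letters; every constant explicit and crude; nothing of Bałaban's analysis asserted ([Balaban1985RegularSpaces] Lemma 1 (1.24)–(1.26)
p.79, (1.29) p.81 served); the `v`-step, the top small-variation gauge, (L♭)'s start, (D-stage), GAP♯∘, S2β, crux 20520 and `YM3TorusSU2` NOT proved; no registered stub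
closed; rung R3 = SU(2) YM₃ on T³ — NOT d = 4, NOT infinite volume, NOT a mass gap, NOT Clay; the Yang–Mills mass gap is NOT proved.
References: T. Bałaban, CMP **99** (1985) 75–102 [Balaban1985RegularSpaces]; CMP **98** (1985) 17–51 [Balaban1985Averaging]; CMP **109** (1987) 249–301 [Balaban1987RG1].
-/

set_option autoImplicit false

noncomputable section

namespace Summit.QuantumFields.YangMills.Theorems.FluctuationComparisonRegPrIntLS2BetaRelativeTowerSupProfileVar

open Finset
open scoped Real
open Literature.MathematicalPhysics.QuantumLattice (su2Quat)
open Literature.MathematicalPhysics.QuantumFieldTheory.Balaban1983to89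
open T4Continuum BlockAveraging LatticeWordStokes
open B10Eq27TorusAxialLog (rel axialT)
open T4CubeChartGnomonic (SU2)
open T4HaarSU2ExpChart (expPoint)
open T4ExpWindowSmallField (logVec)
open Summit.QuantumFields.YangMills.Theorems.FluctuationComparisonRegPrIntLS2BetaRelativeFieldLetter (dist1_axialAvg_mul_inv_eq_corr)
open Summit.QuantumFields.YangMills.Theorems.FluctuationComparisonRegPrIntLS2BetaWhitneyHatLift (arc_lift_le axialAvg_lift)
open Summit.QuantumFields.YangMills.Theorems.FluctuationComparisonRegPrIntLS2BetaRelativeTowerSupProfile (arc_le_of_axial_pair)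
open Summit.QuantumFields.YangMills.Theorems.FluctuationComparisonRegPrIntLS2BetaWhitneyHatLiftCurvatureSecondOrderGlobal (dist1_plaqHol_lift_le_second_of_forall)

variable {P : Params}

/-- ★★★ **THE ONE-LEVEL SUP STEP WITH THE REFINED LIFT CURVATURE** (`d = 3`; the `s`-step of the two-profile recursion).  As in ✓`arc_le_sup_step_hatLift`:
`X` the coarser field, `V` its hat lift, `W` the current level, comb-axial relative to `V` ((T4)) and averaging to `X` ((T5)); `PlaqSmall aW W` inside the `ℰp`
guard; chords of `X` `≤ aX`; arcs of `X` `≤ s ≤ 1∕4`; and NEW: adjacent TRANSVERSE parallel variations of `log X` `≤ v`.  Then for EVERY bond `b`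
    `arc (W b) ≤ L⁻¹·s + (π∕2)·( N_P·(aW + (L⁻¹)²·(aX + (aX + 12s²)² + 40sv + 8v² + 35s³)) + 2·(((d+2)L)²∕4·aW) )`,
`N_P = (d−1)·((L−1)∕2)·(L+1)` — NO `s²` term. [cite: Balaban1985RegularSpaces, Lemma 1 (1.24)-(1.26) p.79, (1.29) p.81; Balaban1987RG1, (0.4) p.253] -/
theorem arc_le_sup_step_hatLift_var (hd : P.d = 3) {t : ℕ} (ht : t + 1 ≤ P.m + P.K) (w : PBond P t → PBond P (t + 1) → ℝ)
    (hw : ∀ b e, w b e = if e.dir = b.dir ∧ (b.src b.dir - emb e.src b.dir).val < P.L then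
      ∏ ν ∈ Finset.univ.erase b.dir, max 0 (1 - ((rel (emb e.src) b.src ν).natAbs : ℝ) / P.L) else 0)
    (X : GaugeField P (t + 1) SU2) (V : GaugeField P t SU2)
    (hV : ∀ b, V b = expPoint (∑ e, w b e • ((P.L : ℝ)⁻¹ • logVec (su2Quat (X e)))))
    (W : GaugeField P t SU2)
    (hax : ∀ z : Site P t, axialT W (emb (blockOf z)) z = axialT V (emb (blockOf z)) z)
    (hT5 : avgFun T3UnitLawDensityEML.ℰp W = X)
    {aW aX s v : ℝ} (haW : 0 ≤ aW) (hWs : PlaqSmall aW W)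
    (hg1 : ((((P.d + 2) * P.L : ℕ) : ℝ) ^ 2 / 4) * aW < ExpMeanLog.deltaSU (Fin 2))
    (hg2 : ((((P.d + 2) * P.L : ℕ) : ℝ) ^ 2 / 4) * aW ≤ 1 / 6)
    (hXp : ∀ q : Plaq P (t + 1), dist1 (GaugeField.plaqHol X q) ≤ aX)
    (hs : ∀ e : PBond P (t + 1), ‖logVec (su2Quat (X e))‖ ≤ s) (hs4 : s ≤ 1 / 4)
    (hv : ∀ (y : Site P (t + 1)) (ι κ : Fin P.d), ι ≠ κ →
      ‖logVec (su2Quat (X ⟨y.shift ι, κ⟩)) - logVec (su2Quat (X ⟨y, κ⟩))‖ ≤ v)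
    (b : PBond P t) :
    ‖logVec (su2Quat (W b))‖ ≤ (P.L : ℝ)⁻¹ * s +
      π / 2 * ((((P.d - 1) * ((P.L - 1) / 2) * (P.L + 1) : ℕ) : ℝ) *
          (aW + ((P.L : ℝ)⁻¹) ^ 2 * (aX + (aX + 12 * s ^ 2) ^ 2 + 40 * s * v + 8 * v ^ 2 + 35 * s ^ 3)) +
        2 * (((((P.d + 2) * P.L : ℕ) : ℝ) ^ 2 / 4) * aW)) := by
  obtain ⟨e₀⟩ : Nonempty (PBond P (t + 1)) := ⟨⟨default, ⟨0, P.hd⟩⟩⟩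
  have hs0 : 0 ≤ s := (norm_nonneg _).trans (hs e₀)
  have hv0 : 0 ≤ v := (norm_nonneg _).trans (hv default ⟨0, P.hd⟩ ⟨1, by rw [hd]; norm_num⟩ (by simp [Fin.ext_iff]))
  have haX : 0 ≤ aX := (GaugeGroup.dist1_nonneg _).trans (hXp ⟨default, ⟨0, P.hd⟩, ⟨1, by rw [hd]; norm_num⟩, by simp [Fin.lt_def]⟩)
  -- plaquettes of `W`
  have hWp : ∀ p : Plaq P t, dist1 (GaugeField.plaqHol W p) ≤ aW := fun p => (hWs p).le
  -- plaquettes of the lift: THE REFINED LETTER (global two-profile form)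
  have hVp : ∀ p : Plaq P t, dist1 (GaugeField.plaqHol V p)
      ≤ ((P.L : ℝ)⁻¹) ^ 2 * (aX + (aX + 12 * s ^ 2) ^ 2 + 40 * s * v + 8 * v ^ 2 + 35 * s ^ 3) := fun p =>
    dist1_plaqHol_lift_le_second_of_forall hd ht w hw X V hV hs hs4 hXp hv p
  -- bonds of the lift
  have hVb : ∀ b : PBond P t, ‖logVec (su2Quat (V b))‖ ≤ (P.L : ℝ)⁻¹ * s := fun b =>
    arc_lift_le ht w hw X V hV b fun e _ => hs e
  -- spine quotient = correction factor ≤ 2·(loop bound)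
  have havg : ∀ c : PBond P (t + 1), AveragingRT.axialAvg V c = avgFun T3UnitLawDensityEML.ℰp W c := fun c => by
    rw [axialAvg_lift ht w hw X V hV, hT5]
  have hsp : ∀ c : PBond P (t + 1), dist1 (AveragingRT.axialAvg W c * (AveragingRT.axialAvg V c)⁻¹) ≤
      2 * (((((P.d + 2) * P.L : ℕ) : ℝ) ^ 2 / 4) * aW) := fun c => by
    rw [dist1_axialAvg_mul_inv_eq_corr _ W V c (havg c)]
    exact BlockAveragingEMLProp2.dist1_corr_le_two_mul W c (fun i => dist1_loopHol_le haW hWs c i) hg1 hg2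
  have hU0 : 0 ≤ ((P.L : ℝ)⁻¹) ^ 2 * (aX + (aX + 12 * s ^ 2) ^ 2 + 40 * s * v + 8 * v ^ 2 + 35 * s ^ 3) := by positivity
  have hS0 : 0 ≤ 2 * (((((P.d + 2) * P.L : ℕ) : ℝ) ^ 2 / 4) * aW) := by positivity
  exact arc_le_of_axial_pair ht W V hax haW hU0 hS0 hWp hVp hsp hVb b

end Summit.QuantumFields.YangMills.Theorems.FluctuationComparisonRegPrIntLS2BetaRelativeTowerSupProfileVar

end
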